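import Summits.BirchSwinnertonDyer.Rank1Residual.P2.CMKolyvaginHabitatTamagawaMordell
import Summits.BirchSwinnertonDyer.Rank1Residual.P2.CMKolyvaginHabitatCubeSums
import HarnessLib

/-!
# Route `CMKolyvaginAtInertTwo` (leaf `WAllCornerFTwo`): the WHOLE `j = 0` CLASS against the habitat
# `H₂` — every arithmetic binder of a Mordell curve `y² = x³ + k` decided by the arithmetic of `k`

Cell `bsd-print-cf2`, seat ty2 (discharge interface), line `route-BirchSwinnertonDyer-CMKolyvaginAtInertTwo`
(items stmt-BirchSwinnertonDyer-22835 `CMPrimitiveSupplyAtInertTwo`, 22836 `CMKolyvaginExactAtInertTwo`,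
residual 22838 `OffHabitatCMResidualAtTwo`). HONEST FRAMING: THEOREMS ONLY — no definition, no named
fact, no route file imported, nothing about BSD asserted or booked; the leaf is OPEN. The items quantify
over `W` in the habitat

  `H₂(W) : W.HasCM ∧ CMInert W 2 ∧ W.HasSurjectiveModNGaloisRep 2 ∧ Odd W.tamagawaProduct ∧
          (∃ Dt, Λ_E ⊆ c·Λ_f ∧ Odd c)`   (+ `W.analyticRank = 1`, + the field / `M₀` binders),

and every `j = 0` curve over `ℚ` is a model of some `y² = x³ + k`, `k ∈ ℤ ∖ {0}`. This file says, for
EVERY such model `W` (`C • (y² = x³ + k) = W`), which binders hold — by name, from the seat's files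
`CMKolyvaginHabitatImageAtTwo` (ρ̄₂), `CMKolyvaginHabitatTamagawaMordell` (∏ c_ℓ),
`CMKolyvaginHabitatManinAtTwo` (Manin, modulo Abbes–Ullmo) and the tree's `CornerFTwoModelClasses`
(CM, `2` inert) — generalising `CMKolyvaginHabitatCubeSums` (the case `k = −432n²`). With
`a_p = v_p(k)`, `u_p = k/p^{a_p}`:

* `hasCM_and_cmInert_two_of_model` — CM by `ℤ[ζ₃]`, `2` inert: ALWAYS;
* `hasSurjectiveModNGaloisRep_two_of_model_iff` — `ρ̄₂` onto ⟺ `k` is not a cube (in `ℚ`, equivalently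
  in `ℤ`: `exists_rat_pow_three_eq_iff`);
* `odd_tamagawaProduct_of_model_iff` (companion) — `Odd ∏ c_ℓ` ⟺ ¬[a₂ ≡ 3 (6) ∨ (a₂ ≡ 2 (6) ∧ u₂ ≡ 3 (4))]
  ∧ ¬[a₃ ≡ 0 (3) ∧ u₃ ≡ ±1 (9)] ∧ ∀ p ≥ 5, a_p ≡ 3 (6) → u_p non-cube mod p;
* `hasGoodReductionAtPrime_two_of_model_iff` — good at `2` ⟺ `a₂ ≡ 4 (6) ∧ u₂ ≡ 1 (4)` (the tree's
  `2`-adic table), whence `maninBinder_of_model` — on that slice the Manin binder follows from "`W`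
  optimal" alone, modulo `hAU`;
* `arithmeticHabitat_of_model_iff` — the conjunction `CM ∧ inert ∧ ρ̄₂ onto ∧ Odd ∏c` DECIDED;
  `habitat_of_model` — the literal hypothesis block of 22835/22836 between `HasCM` and `analyticRank`,
  for a globally minimal optimal model good at `2`; `not_arithmeticHabitat_of_model_of_cube` /
  `…_of_not_tamagawa` — the residual side (item 22838).

What is NOT decided here: `W.analyticRank = 1` (the genuine hypothesis), optimality of `W`, and the
Manin binder for the members that are BAD at `2` (no Abbes–Ullmo there; it stays a hypothesis).
References: the files named above; [SilvermanATAEC1994] IV.9.4; [Rizzo2003] Table II;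
[DokchitserDokchitserMathZ2012] Thm. (1); [AbbesUllmo1996] Thm. A; [Cox2013] §9.A.
-/

set_option autoImplicit false

noncomputable section

open scoped Classical NumberField

open WeierstrassCurve NumberField IsDedekindDomain IsDedekindDomain.HeightOneSpectrum Rat.HeightOneSpectrum
  Literature.NumberTheory.EllipticCurves Literature.NumberTheory.EllipticCurves.Rank1Residual
  Literature.NumberTheory.EllipticCurves.ModularForms Literature.NumberTheory.DiophantineGeometry

namespace Summit.BirchSwinnertonDyer.Rank1Residual.P2.Mordell

variable (W : WeierstrassCurve ℚ) [W.IsElliptic] {k : ℤ}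

/-! ## §1 CM, inertness, image -/

omit [W.IsElliptic] in
/-- A model `W = C • (y² = x³ + k)` in the shape `∃ C', C' • W = (y² = x³ + k)` used by the
local-type files. [folklore] -/
theorem exists_smul_eq_mordell {C : VariableChange ℚ}
    (hC : C • (⟨0, 0, 0, 0, (k : ℚ)⟩ : WeierstrassCurve ℚ) = W) :
    ∃ C' : VariableChange ℚ, C' • W = ⟨0, 0, 0, 0, (k : ℚ)⟩ :=
  ⟨C⁻¹, by rw [← hC, inv_smul_smul]⟩

/-- **Every model of `y² = x³ + k` (`k ≠ 0`) has CM (by `ℤ[ζ₃]`, `j = 0`) with `2` INERT in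
`ℚ(√−3)`.** (`CornerFTwoModelClasses.hasCM_and_cmInert_two_of_smul_sextic`.) [cite: Cox2013, §9.A and Cor. 5.17] -/
theorem hasCM_and_cmInert_two_of_model (hk : k ≠ 0) {C : VariableChange ℚ}
    (hC : C • (⟨0, 0, 0, 0, (k : ℚ)⟩ : WeierstrassCurve ℚ) = W) : W.HasCM ∧ CMInert W 2 :=
  CornerFTwo.hasCM_and_cmInert_two_of_smul_sextic (W := W) (B := (k : ℚ)) (by exact_mod_cast hk) hC

/-- **Every model of `y² = x³ + k` (`k ≠ 0`): `ρ̄_{E,2}` is onto `GL₂(𝔽₂)` iff `k` is not a rational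
cube** (the `2`-division cubic is `4(x³ + k)`, `Δ ∉ ℚ^{×2}`). [cite: DokchitserDokchitserMathZ2012, Theorem (1)]
[cite: SilvermanAEC2009, III §1 and X §1] -/
theorem hasSurjectiveModNGaloisRep_two_of_model_iff {C : VariableChange ℚ}
    (hC : C • (⟨0, 0, 0, 0, (k : ℚ)⟩ : WeierstrassCurve ℚ) = W) :
    W.HasSurjectiveModNGaloisRep 2 ↔ ¬ ∃ t : ℚ, t ^ 3 = (k : ℚ) := by
  rw [hasSurjectiveModNGaloisRep_two_iff_of_smul_eq W hC (c₄_mk_a₆ _), exists_cube_two_mul_c₆_mk_a₆_iff]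

/-- `k ∈ ℤ` is a rational cube iff it is an integer cube (`ℤ` is integrally closed). [folklore] -/
theorem exists_rat_pow_three_eq_iff (k : ℤ) : (∃ t : ℚ, t ^ 3 = (k : ℚ)) ↔ ∃ t : ℤ, t ^ 3 = k := by
  constructor
  · rintro ⟨t, ht⟩
    have hint : IsIntegral ℤ t := by
      refine IsIntegral.of_pow (by norm_num : 0 < 3) ?_
      rw [ht, ← eq_intCast (algebraMap ℤ ℚ) k]
      exact isIntegral_algebraMap
    obtain ⟨y, hy⟩ := IsIntegrallyClosed.isIntegral_iff.mp hint
    refine ⟨y, ?_⟩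
    have : ((y ^ 3 : ℤ) : ℚ) = (k : ℚ) := by push_cast; rw [← ht, ← hy]; rfl
    exact_mod_cast this
  · rintro ⟨t, rfl⟩
    exact ⟨t, by push_cast; ring⟩

/-- **Integer form of the image binder:** `ρ̄_{E,2}` onto iff `k` is not an integer cube.
[cite: DokchitserDokchitserMathZ2012, Theorem (1)] -/
theorem hasSurjectiveModNGaloisRep_two_of_model_iff_int {C : VariableChange ℚ}
    (hC : C • (⟨0, 0, 0, 0, (k : ℚ)⟩ : WeierstrassCurve ℚ) = W) :
    W.HasSurjectiveModNGaloisRep 2 ↔ ¬ ∃ t : ℤ, t ^ 3 = k := by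
  rw [hasSurjectiveModNGaloisRep_two_of_model_iff W hC, exists_rat_pow_three_eq_iff]

/-! ## §2 Good reduction at `2` and the Manin binder -/

/-- **Every model of `y² = x³ + k` has good reduction at `2` iff `v₂(k) ≡ 4 (mod 6)` and
`k/2^{v₂(k)} ≡ 1 (mod 4)`** (the row `y² = x³ + 16u`, `u ≡ 1 (4)`, of the tree's `2`-adic table is
`y² + y = x³ + (u−1)/4`; every other row is bad: types II, IV, I₀*, IV*, II*).
[cite: SilvermanATAEC1994, IV.9.4 (PDF pp. 344–346) and Table 4.1] [cite: SilvermanAEC2009, VII.5 Prop. 5.1 (a)] -/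
theorem hasGoodReductionAt_two_of_model_iff (hk : k ≠ 0) {C : VariableChange ℚ}
    (hC : C • (⟨0, 0, 0, 0, (k : ℚ)⟩ : WeierstrassCurve ℚ) = W) (v : HeightOneSpectrum (𝓞 ℚ))
    (hv : natGenerator v = 2) :
    W.HasGoodReductionAt v ↔
      (k.natAbs.factorization 2 % 6 = 4 ∧ k / (2 : ℤ) ^ k.natAbs.factorization 2 % 4 = 1) := by
  haveI : PerfectField (IsLocalRing.ResidueField (v.adicCompletionIntegers ℚ)) := PerfectField.ofFinite
  obtain ⟨D, hD⟩ := exists_smul_eq_reduced Nat.prime_two hk W (exists_smul_eq_mordell W hC)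
  obtain ⟨-, hup, hu0⟩ := eq_pow_mul_reduced (k := k) Nat.prime_two hk
  simp only [Nat.cast_ofNat] at hD hup hu0
  set a := k.natAbs.factorization 2 with ha
  set u : ℤ := k / (2 : ℤ) ^ a with hu
  set M : WeierstrassCurve ℚ := ⟨0, 0, 0, 0, (((2 : ℤ) ^ (a % 6) * u : ℤ) : ℚ)⟩ with hMdef
  haveI : M.IsElliptic := by rw [← hD]; infer_instance
  have e₁ : M.a₁ = 0 := rfl; have e₂ : M.a₂ = 0 := rfl; have e₃ : M.a₃ = 0 := rfl
  have e₄ : M.a₄ = 0 := rfl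
  -- `W` good at `v` iff `M` is
  rw [← hasGoodReductionAt_smul_iff_holds v W D, hD]
  -- bad rows: `ord Δ_min ≠ 0`
  have hbad : ∀ {n : ℕ}, M.ordMinimalDiscriminant v = n → n ≠ 0 → ¬ M.HasGoodReductionAt v :=
    fun hn hn0 hg => hn0 (hn ▸ (ordMinimalDiscriminant_eq_zero_iff_holds v M).mpr hg)
  have hu4 : u % 4 = 1 ∨ u % 4 = 3 := by omega
  constructor
  · intro hg
    rcases (show a % 6 = 0 ∨ a % 6 = 1 ∨ a % 6 = 2 ∨ a % 6 = 3 ∨ a % 6 = 4 ∨ a % 6 = 5 by omega) with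
      h0 | h1 | h2 | h3 | h4 | h5
    · have e₆ : M.a₆ = (u : ℚ) := by simp [hMdef, h0]
      rcases hu4 with h41 | h43
      · exact absurd hg (hbad (kodairaSymbolAt_and_ordMinimalDiscriminant_mordell_zero_of_emod_four_eq_one
          v hv M e₁ e₂ e₃ e₄ h41 e₆).2 (by norm_num))
      · exact absurd hg (hbad (kodairaSymbolAt_and_ordMinimalDiscriminant_mordell_zero_of_emod_four_eq_three
          v hv M e₁ e₂ e₃ e₄ h43 e₆).2 (by norm_num))
    · have e₆ : M.a₆ = ((2 * u : ℤ) : ℚ) := by simp [hMdef, h1]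
      exact absurd hg (hbad (kodairaSymbolAt_and_ordMinimalDiscriminant_mordell_one v hv M e₁ e₂ e₃ e₄
        hup e₆).2 (by norm_num))
    · have e₆ : M.a₆ = ((4 * u : ℤ) : ℚ) := by simp [hMdef, h2]
      rcases hu4 with h41 | h43
      · exact absurd hg (hbad (kodairaSymbolAt_and_ordMinimalDiscriminant_mordell_two_of_emod_four_eq_one
          v hv M e₁ e₂ e₃ e₄ h41 e₆).2 (by norm_num))
      · exact absurd hg (hbad (kodairaSymbolAt_and_ordMinimalDiscriminant_mordell_two_of_emod_four_eq_three
          v hv M e₁ e₂ e₃ e₄ h43 e₆).2 (by norm_num))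
    · have e₆ : M.a₆ = ((8 * u : ℤ) : ℚ) := by simp [hMdef, h3]
      exact absurd hg (hbad (kodairaSymbolAt_and_ordMinimalDiscriminant_mordell_three v hv M e₁ e₂ e₃ e₄
        hup e₆).2 (by norm_num))
    · have e₆ : M.a₆ = ((16 * u : ℤ) : ℚ) := by simp [hMdef, h4]
      rcases hu4 with h41 | h43
      · exact ⟨h4, h41⟩
      · exact absurd hg (hbad (kodairaSymbolAt_and_ordMinimalDiscriminant_mordell_four_of_emod_four_eq_three
          v hv M e₁ e₂ e₃ e₄ h43 e₆).2 (by norm_num))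
    · have e₆ : M.a₆ = ((32 * u : ℤ) : ℚ) := by simp [hMdef, h5]
      exact absurd hg (hbad (kodairaSymbolAt_and_ordMinimalDiscriminant_mordell_five v hv M e₁ e₂ e₃ e₄
        hup e₆).2 (by norm_num))
  · rintro ⟨h4, h41⟩
    have e₆ : M.a₆ = ((16 * u : ℤ) : ℚ) := by simp [hMdef, h4]
    exact hasGoodReductionAt_mordell_four_of_emod_four_eq_one v hv M e₁ e₂ e₃ e₄ h41 e₆

/-- **Prime-indexed form: every model of `y² = x³ + k` is good at the prime `2` iff
`v₂(k) ≡ 4 (mod 6)` and `k/2^{v₂(k)} ≡ 1 (mod 4)`.** [cite: SilvermanATAEC1994, IV.9.4 and Table 4.1]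
[cite: SilvermanAEC2009, VII.5 Prop. 5.1 (a)] -/
theorem hasGoodReductionAtPrime_two_of_model_iff (hk : k ≠ 0) {C : VariableChange ℚ}
    (hC : C • (⟨0, 0, 0, 0, (k : ℚ)⟩ : WeierstrassCurve ℚ) = W) :
    W.HasGoodReductionAtPrime 2 ↔
      (k.natAbs.factorization 2 % 6 = 4 ∧ k / (2 : ℤ) ^ k.natAbs.factorization 2 % 4 = 1) := by
  obtain ⟨v, hv⟩ := exists_place_natGenerator_eq Nat.prime_two
  haveI : Fact (Nat.Prime 2) := ⟨Nat.prime_two⟩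
  rw [hasGoodReductionAtPrime_primesEquiv_iff_holds W v 2 hv]
  exact hasGoodReductionAt_two_of_model_iff W hk hC v hv

/-- **The habitat's MANIN binder on the good-at-2 slice of the `j = 0` class:** for a globally minimal
model `W` of `y² = x³ + k` with `v₂(k) ≡ 4 (mod 6)`, `k/2^{v₂(k)} ≡ 1 (mod 4)`, "`W` optimal" gives
`∃ Dt, Λ_E ⊆ c·Λ_f ∧ Odd c`, modulo Abbes–Ullmo. [cite: AbbesUllmo1996, Thm. A] -/
theorem maninBinder_of_model [W.IsGloballyMinimal] [NeZero (W.conductorNorm ℤ)]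
    (hAU : abbesUllmo_not_dvd_maninConstant_of_not_dvd_level) (hk : k ≠ 0) {C : VariableChange ℚ}
    (hC : C • (⟨0, 0, 0, 0, (k : ℚ)⟩ : WeierstrassCurve ℚ) = W)
    (h2 : k.natAbs.factorization 2 % 6 = 4 ∧ k / (2 : ℤ) ^ k.natAbs.factorization 2 % 4 = 1)
    (hopt : ∃ Dt : ModularParametrizationData W (W.conductorNorm ℤ), ShuZhai2021.IsOptimalDatum W Dt) :
    ∃ Dt : ModularParametrizationData W (W.conductorNorm ℤ),
      (∀ z ∈ Dt.L.lattice, ∃ w ∈ periodLattice Dt.f, z = (Dt.c : ℂ) * w) ∧ Odd Dt.c :=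
  maninBinder_of_exists_isOptimalDatum_of_hasGoodReductionAtPrime_two W hAU
    ((hasGoodReductionAtPrime_two_of_model_iff W hk hC).mpr h2) hopt

/-! ## §3 The arithmetic habitat on the `j = 0` class, decided -/

/-- **THE ARITHMETIC BINDERS OF `H₂` ON THE `j = 0` CLASS, DECIDED.** For `k ≠ 0` and EVERY model
`W` of `y² = x³ + k`:
`(W.HasCM ∧ CMInert W 2 ∧ ρ̄₂ onto ∧ Odd ∏ c_ℓ) ⟺ (k ∉ ℚ³ ∧ the three-clause Tamagawa criterion)`.
[cite: DokchitserDokchitserMathZ2012, Theorem (1)] [cite: SilvermanATAEC1994, IV.9.4 and Table 4.1]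
[cite: Rizzo2003, Table II (p. 4)] [cite: Cox2013, §9.A] -/
theorem arithmeticHabitat_of_model_iff (hk : k ≠ 0) {C : VariableChange ℚ}
    (hC : C • (⟨0, 0, 0, 0, (k : ℚ)⟩ : WeierstrassCurve ℚ) = W) :
    (W.HasCM ∧ CMInert W 2 ∧ W.HasSurjectiveModNGaloisRep 2 ∧ Odd W.tamagawaProduct) ↔
      ((¬ ∃ t : ℚ, t ^ 3 = (k : ℚ)) ∧
        ¬ (k.natAbs.factorization 2 % 6 = 3 ∨
            (k.natAbs.factorization 2 % 6 = 2 ∧ k / (2 : ℤ) ^ k.natAbs.factorization 2 % 4 = 3)) ∧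
        ¬ (k.natAbs.factorization 3 % 3 = 0 ∧
            (k / 3 ^ k.natAbs.factorization 3 % 9 = 1 ∨ k / 3 ^ k.natAbs.factorization 3 % 9 = 8)) ∧
        ∀ p : ℕ, p.Prime → 5 ≤ p → k.natAbs.factorization p % 6 = 3 →
          ¬ ∃ s : ZMod p, s ^ 3 = ((k / (p : ℤ) ^ k.natAbs.factorization p : ℤ) : ZMod p)) := by
  obtain ⟨hCM, hin⟩ := hasCM_and_cmInert_two_of_model W hk hC
  rw [hasSurjectiveModNGaloisRep_two_of_model_iff W hC,
    odd_tamagawaProduct_of_model_iff W hk (exists_smul_eq_mordell W hC)]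
  exact ⟨fun h => ⟨h.2.2.1, h.2.2.2⟩, fun h => ⟨hCM, hin, h.1, h.2⟩⟩

/-- **`k` a cube: the image binder fails for every model** (a rational `2`-torsion point), so these
curves — `y² = x³ + t³`, the `36a1`/`144a1`-type twists of the Shu–Zhai doors — are residual (22838).
[cite: DokchitserDokchitserMathZ2012, Theorem (1)] -/
theorem not_arithmeticHabitat_of_model_of_cube {C : VariableChange ℚ}
    (hC : C • (⟨0, 0, 0, 0, (k : ℚ)⟩ : WeierstrassCurve ℚ) = W) (ht : ∃ t : ℤ, t ^ 3 = k)
    {P Q R S : Prop} : ¬ (P ∧ Q ∧ W.HasSurjectiveModNGaloisRep 2 ∧ R ∧ S) :=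
  fun h => (hasSurjectiveModNGaloisRep_two_of_model_iff_int W hC).mp h.2.2.1 ht

/-- **The Tamagawa binder fails: every model is residual** (item 22838), whatever the other binders —
at `2` (`I₀*`), at `3` (III/III*), or at some `p ≥ 5` (`I₀*` with `u_p` a cube).
[cite: SilvermanATAEC1994, IV.9.4 and Table 4.1] [cite: Rizzo2003, Table II (p. 4)] -/
theorem not_arithmeticHabitat_of_model_of_not_tamagawa (hk : k ≠ 0) {C : VariableChange ℚ}
    (hC : C • (⟨0, 0, 0, 0, (k : ℚ)⟩ : WeierstrassCurve ℚ) = W)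
    (h : (k.natAbs.factorization 2 % 6 = 3 ∨
          (k.natAbs.factorization 2 % 6 = 2 ∧ k / (2 : ℤ) ^ k.natAbs.factorization 2 % 4 = 3)) ∨
        (k.natAbs.factorization 3 % 3 = 0 ∧
          (k / 3 ^ k.natAbs.factorization 3 % 9 = 1 ∨ k / 3 ^ k.natAbs.factorization 3 % 9 = 8)) ∨
        ∃ p : ℕ, p.Prime ∧ 5 ≤ p ∧ k.natAbs.factorization p % 6 = 3 ∧
          ∃ s : ZMod p, s ^ 3 = ((k / (p : ℤ) ^ k.natAbs.factorization p : ℤ) : ZMod p))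
    {P Q R : Prop} : ¬ (P ∧ Q ∧ Odd W.tamagawaProduct ∧ R) := by
  intro hab
  have hodd := (odd_tamagawaProduct_of_model_iff W hk (exists_smul_eq_mordell W hC)).mp hab.2.2.1
  rcases h with h | h | ⟨p, hp, hp5, ha, hs⟩
  · exact hodd.1 h
  · exact hodd.2.1 h
  · exact hodd.2.2 p hp hp5 ha hs

/-- **THE `j = 0` CLASS IN `H₂` (all binders but the analytic rank), good-at-2 slice:** for a
globally minimal OPTIMAL model `W` of `y² = x³ + k` with `k ∉ ℤ³`, the Tamagawa criterion, and
`v₂(k) ≡ 4 (mod 6)`, `k/2^{v₂(k)} ≡ 1 (mod 4)` (good at `2`), modulo Abbes–Ullmo: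
`CMInert W 2 ∧ ρ̄₂ onto ∧ Odd ∏c ∧ (∃ Dt, Λ_E ⊆ c·Λ_f ∧ Odd c)` — the literal hypothesis block of items
22835/22836 after `W.HasCM` and before `W.analyticRank = 1`. (The clause at `2` of the Tamagawa
criterion is then automatic.) [cite: DokchitserDokchitserMathZ2012, Thm. (1)]
[cite: SilvermanATAEC1994, IV.9.4 and Table 4.1] [cite: Rizzo2003, Table II (p. 4)] [cite: AbbesUllmo1996, Thm. A] -/
theorem habitat_of_model [W.IsGloballyMinimal] [NeZero (W.conductorNorm ℤ)]
    (hAU : abbesUllmo_not_dvd_maninConstant_of_not_dvd_level) (hk : k ≠ 0) {C : VariableChange ℚ}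
    (hC : C • (⟨0, 0, 0, 0, (k : ℚ)⟩ : WeierstrassCurve ℚ) = W) (hcube : ¬ ∃ t : ℤ, t ^ 3 = k)
    (h2 : k.natAbs.factorization 2 % 6 = 4 ∧ k / (2 : ℤ) ^ k.natAbs.factorization 2 % 4 = 1)
    (h3 : ¬ (k.natAbs.factorization 3 % 3 = 0 ∧
      (k / 3 ^ k.natAbs.factorization 3 % 9 = 1 ∨ k / 3 ^ k.natAbs.factorization 3 % 9 = 8)))
    (h5 : ∀ p : ℕ, p.Prime → 5 ≤ p → k.natAbs.factorization p % 6 = 3 →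
      ¬ ∃ s : ZMod p, s ^ 3 = ((k / (p : ℤ) ^ k.natAbs.factorization p : ℤ) : ZMod p))
    (hopt : ∃ Dt : ModularParametrizationData W (W.conductorNorm ℤ), ShuZhai2021.IsOptimalDatum W Dt) :
    W.HasCM ∧ (CMInert W 2 ∧ W.HasSurjectiveModNGaloisRep (2 : ℤ) ∧ Odd W.tamagawaProduct ∧
      ∃ Dt : ModularParametrizationData W (W.conductorNorm ℤ),
        (∀ z ∈ Dt.L.lattice, ∃ w ∈ periodLattice Dt.f, z = (Dt.c : ℂ) * w) ∧ Odd Dt.c) := by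
  have htam : ¬ (k.natAbs.factorization 2 % 6 = 3 ∨
      (k.natAbs.factorization 2 % 6 = 2 ∧ k / (2 : ℤ) ^ k.natAbs.factorization 2 % 4 = 3)) := by
    omega
  obtain ⟨hCM, hin, hs, ht⟩ := (arithmeticHabitat_of_model_iff W hk hC).mpr
    ⟨fun h => hcube ((exists_rat_pow_three_eq_iff k).mp h), htam, h3, h5⟩
  exact ⟨hCM, hin, hs, ht, maninBinder_of_model W hAU hk hC h2 hopt⟩

/-- **The `j = 0` class in `H₂`, bad-at-2 members:** same as `habitat_of_model` with the Manin binder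
kept as a hypothesis (no Abbes–Ullmo off the good-at-2 slice). [cite: DokchitserDokchitserMathZ2012, Thm. (1)]
[cite: SilvermanATAEC1994, IV.9.4 and Table 4.1] [cite: Rizzo2003, Table II (p. 4)] -/
theorem habitat_of_model_of_maninBinder [NeZero (W.conductorNorm ℤ)] (hk : k ≠ 0)
    {C : VariableChange ℚ} (hC : C • (⟨0, 0, 0, 0, (k : ℚ)⟩ : WeierstrassCurve ℚ) = W)
    (hcube : ¬ ∃ t : ℤ, t ^ 3 = k)
    (h2 : ¬ (k.natAbs.factorization 2 % 6 = 3 ∨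
      (k.natAbs.factorization 2 % 6 = 2 ∧ k / (2 : ℤ) ^ k.natAbs.factorization 2 % 4 = 3)))
    (h3 : ¬ (k.natAbs.factorization 3 % 3 = 0 ∧
      (k / 3 ^ k.natAbs.factorization 3 % 9 = 1 ∨ k / 3 ^ k.natAbs.factorization 3 % 9 = 8)))
    (h5 : ∀ p : ℕ, p.Prime → 5 ≤ p → k.natAbs.factorization p % 6 = 3 →
      ¬ ∃ s : ZMod p, s ^ 3 = ((k / (p : ℤ) ^ k.natAbs.factorization p : ℤ) : ZMod p))
    (hM : ∃ Dt : ModularParametrizationData W (W.conductorNorm ℤ),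
      (∀ z ∈ Dt.L.lattice, ∃ w ∈ periodLattice Dt.f, z = (Dt.c : ℂ) * w) ∧ Odd Dt.c) :
    W.HasCM ∧ (CMInert W 2 ∧ W.HasSurjectiveModNGaloisRep (2 : ℤ) ∧ Odd W.tamagawaProduct ∧
      ∃ Dt : ModularParametrizationData W (W.conductorNorm ℤ),
        (∀ z ∈ Dt.L.lattice, ∃ w ∈ periodLattice Dt.f, z = (Dt.c : ℂ) * w) ∧ Odd Dt.c) := by
  obtain ⟨hCM, hin, hs, ht⟩ := (arithmeticHabitat_of_model_iff W hk hC).mpr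
    ⟨fun h => hcube ((exists_rat_pow_three_eq_iff k).mp h), h2, h3, h5⟩
  exact ⟨hCM, hin, hs, ht, hM⟩

end Summit.BirchSwinnertonDyer.Rank1Residual.P2.Mordell

end
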